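import Literature.NumberTheory.DiophantineGeometry.AbelianSchemeModelReductionInertia
import Literature.NumberTheory.DiophantineGeometry.AbelianSchemeModelReductionTorsionBijective
import HarnessLib

/-!
# «Good reduction ⇒ `T_ℓ A` unramified» from the abelian-scheme bridge r₀ (Serre–Tate 1968 §1 Thm. 1, easy direction)

Layer `Literature/NumberTheory/DiophantineGeometry`, namespace `Literature.NumberTheory.DiophantineGeometry`.  THEOREMS ONLY
(no definition, no named fact, no instance; net Literature debt **0**).  Cell `hodgecm-mathlib` (D-0151), the h21 inertia chain
(director g3 BATCH 77–81, J-h12 = (b)): the consumer-side VI-NOS edition of `h21` (`TorsionReciprocityReductionInertia`,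
`ShimuraTaniyamaOfMainTheoremInertia`, `Theorems/HCCMUnconditionalH21OfLevelStructure` §Appendix) needs, at EVERY place `v` where the
VARIETY of `A` has a smooth proper model (`HasGoodReductionAt A.X A.dim v`, `Motives/GoodReduction`) and for every prime `ℓ ∤ v`, a
prime `𝔓 ∣ v` of `ℤ̄_K` whose inertia group acts trivially on `T_ℓ A` — the hypothesis `h₁₂`.  This file derives `h₁₂` from

* the bridge **r₀** «a smooth proper model of an abelian variety is an abelian scheme» — taken AS A HYPOTHESIS, spelled exactly as the
  body of the cell's named fact `exists_isAbelianSchemeModel_of_hasGoodReductionAt` (B-typ01, `AbelianSchemeModelOfSmoothProperModel`;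
  [BLRNeronModels1990] 1.2/8, 4.4/1) so that this file does not depend on that module, and
* the cell's PROVED Serre–Tate §1 chain in produced currency: Lemma 2 «the reduction map is injective on `A[ℓⁿ](K̄)` for `(ℓ) ∉ v`»
  (B-p07 `IsAbelianSchemeModel.specialFibreReductionHom_injOn_geomTorsion_pow`, T1) and «injective on `ℓ`-power torsion ⇒ the
  inertia of `𝔓ᵥ = adicCompletionPrime K v` acts trivially on `T_ℓ A`» (B-p09
  `IsAbelianSchemeModel.exists_primesAbove_forall_inertia_tateRep_eq_one_of_injOn`, T4b).

HC_CM is proved only modulo the 7 printed citations until rung 0 closes; with this file the `h21` leaf `h₁₂` is replaced by the bare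
algebraic-geometry bridge r₀.

## References
* [SerreTate1968] J.-P. Serre, J. Tate, *Good reduction of abelian varieties*, Ann. of Math. 88 (1968), §1 Thm. 1 and Lemma 2.
* [BLRNeronModels1990] S. Bosch, W. Lütkebohmert, M. Raynaud, *Néron Models* (1990), §1.2 Prop. 8, §4.4 Thm. 1, §7.3.
* [Shimura1998] G. Shimura, *Abelian Varieties with Complex Multiplication and Modular Functions* (1998), Lemma 19.5.
-/

set_option autoImplicit false

open CategoryTheory AlgebraicGeometry IsDedekindDomain IsDedekindDomain.HeightOneSpectrum
open scoped MonObj NumberField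
open Literature.AlgebraicGeometry.Motives Literature.AlgebraicGeometry.Motives.AbelianVariety
open Literature.NumberTheory.GaloisRepresentations

namespace Literature.NumberTheory.DiophantineGeometry

/-- **«Good reduction ⇒ `T_ℓ A` unramified at `v`» from the abelian-scheme bridge r₀** ([SerreTate1968] §1 Thm. 1, (a) ⇒ (b) ⇒ (c);
[Shimura1998] Lemma 19.5): if every smooth proper model of (the variety of) an abelian variety carries an abelian-scheme structure
(`hr₀`, the body of `exists_isAbelianSchemeModel_of_hasGoodReductionAt` verbatim), then at every place `v` with
`HasGoodReductionAt A.X A.dim v` and for every prime `ℓ` with `(ℓ) ∉ v` there is a prime `𝔓 ∣ v` of `ℤ̄_K` (namely `adicCompletionPrime K v`)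
whose inertia group acts trivially on `T_ℓ A`.  Proof: r₀ gives an abelian-scheme model `𝒜`; B-p07's Serre–Tate Lemma 2 gives injectivity
of the reduction map on every `A[ℓⁿ](K̄)`; B-p09's T4b turns that into the inertia statement.  This is the hypothesis `h₁₂` of the `h21`
inertia edition, discharged modulo r₀. [cite: SerreTate1968, §1 Thm. 1 and Lemma 2] [cite: BLRNeronModels1990, §1.2 Prop. 8 and §4.4 Thm. 1] -/
theorem forall_inertia_tateRep_eq_one_of_hasGoodReductionAt
    (hr₀ : ∀ {K : Type} [Field K] [NumberField K] (A : AbelianVariety K) (v : HeightOneSpectrum (𝓞 K)),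
      HasGoodReductionAt A.X A.dim v →
        ∃ (𝒜 : SchemeOver (valuationSubringAtPrime K v)) (_ : GrpObj 𝒜), IsAbelianSchemeModel A v 𝒜)
    {K : Type} [Field K] [NumberField K] (A : AbelianVariety K) (v : HeightOneSpectrum (𝓞 K))
    (hgood : HasGoodReductionAt A.X A.dim v) (ℓ : ℕ) [Fact ℓ.Prime] (hℓv : ((ℓ : ℕ) : 𝓞 K) ∉ v.asIdeal) :
    ∃ 𝔓 ∈ v.primesAbove, ∀ σ ∈ 𝔓.inertia (Field.absoluteGaloisGroup K), A.tateRep ℓ σ = 1 := by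
  obtain ⟨𝒜, _, h⟩ := hr₀ A v hgood
  exact h.exists_primesAbove_forall_inertia_tateRep_eq_one_of_injOn ℓ
    (fun n => h.specialFibreReductionHom_injOn_geomTorsion_pow hℓv n)

/-- The same at EVERY prime `𝔓 ∣ v` of `ℤ̄_K` (all inertia groups above `v` are conjugate; B-p09's
`forall_primesAbove_inertia_tateRep_eq_one_of_injOn`). [cite: SerreTate1968, §1 Thm. 1 and Lemma 2] -/
theorem forall_primesAbove_inertia_tateRep_eq_one_of_hasGoodReductionAt
    (hr₀ : ∀ {K : Type} [Field K] [NumberField K] (A : AbelianVariety K) (v : HeightOneSpectrum (𝓞 K)),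
      HasGoodReductionAt A.X A.dim v →
        ∃ (𝒜 : SchemeOver (valuationSubringAtPrime K v)) (_ : GrpObj 𝒜), IsAbelianSchemeModel A v 𝒜)
    {K : Type} [Field K] [NumberField K] (A : AbelianVariety K) (v : HeightOneSpectrum (𝓞 K))
    (hgood : HasGoodReductionAt A.X A.dim v) (ℓ : ℕ) [Fact ℓ.Prime] (hℓv : ((ℓ : ℕ) : 𝓞 K) ∉ v.asIdeal) :
    ∀ 𝔓 ∈ v.primesAbove, ∀ σ ∈ 𝔓.inertia (Field.absoluteGaloisGroup K), A.tateRep ℓ σ = 1 := by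
  obtain ⟨𝒜, _, h⟩ := hr₀ A v hgood
  exact h.forall_primesAbove_inertia_tateRep_eq_one_of_injOn ℓ
    (fun n => h.specialFibreReductionHom_injOn_geomTorsion_pow hℓv n)

end Literature.NumberTheory.DiophantineGeometry
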